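import Mathlib
import Summits.ResolutionOfSingularities.ResolutionOfSingularities.Theorems.WeightedInvariantDatumToEmbeddedAtlasDefs
import Summits.ResolutionOfSingularities.ResolutionOfSingularities.Theorems.WeightedInvariantDatumToEmbeddedAtlasQuotientLocal
import Literature.AlgebraicGeometry.Resolution.CobordantBlowupGlobal
import Literature.AlgebraicGeometry.Resolution.Blowups
import Literature.AlgebraicGeometry.Resolution.BlowupPrincipalCharts
import HarnessLib

/-!
# The quotient chart under an ambient chart, II: `X' ∩ D(β t^{Dg}) = q'⁻¹(V'[U a, b])`

Topic: `Summits/ResolutionOfSingularities/ResolutionOfSingularities/Theorems`. Helper file of the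
stub `stub_qs_atlas_quotient` of the line `Sketch` of the crux
`Theses.WeightedInvariant.DatumToEmbedded` (statement `stmt-ResolutionOfSingularities-0572`) of
the summit `Summit.ResolutionOfSingularities.ResolutionOfSingularities`.

Setting (J. Włodarczyk, arXiv:2203.03090, §2.3.3 "the quotient `B₊⫽𝔾ₘ` is the blow-up";
Stacks 0804, the charts of a blowing up). A graded atlas `𝒜 : GradedAtlas j f i q` of the closed
`i : X ⟶ Y` with quotient `q : X ⟶ V`, a Rees filtration `R'` on `Y` with cobordant blow-up
`πPlus : B₊ = R'.plus ⟶ Y`, the INTEGRAL strict transform `X' = V(R'.strictTransformPlus i.ker)`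
with `i' : X' ⟶ B₊` and `σX : X' ⟶ X` over `i`, on which `t⁻¹` is not identically zero (`hτ`),
an ideal sheaf `K` on `V` (the downstairs centre) and a degree `Dg` with
(A1) `(J Dg) · 𝒪_{B₊} = (t⁻¹)^{Dg}` and (A3) `K · 𝒪_{X'} = (t⁻¹)^{Dg} · 𝒪_{X'}`, a blow-up
`ρ : V' ⟶ V` along `K` with `q' : X' ⟶ V'` over `σX ≫ q`, a chart index `a`, `b ∈ K(U a)` with a
lift `β ∈ (J Dg)(W a)`, `i♯β = q♯b`, and an ambient chart `𝒞 : AmbientChart j f i q 𝒜 J R' Dg a β`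
(`Theorems/WeightedInvariantDatumToEmbeddedAtlasDefs.lean`). Then

* `preimage_W'_le` — `i'⁻¹(𝒞.W') ⊆ q'⁻¹(V'[U a, b])`: at `P` with `i' P ∈ W'`, `𝒞.mem_iff` gives
  `π♯β = η₀ (t⁻¹)^{Dg}` near `i' P` with `η₀` a unit; `q' P` lies in a principal chart `W_m` for
  some `x_m ∈ K(U a)` (`IsBlowup.iSup_blowupChart`), where `ρ♯b = c ρ♯x_m`; on a small affine
  `O'' ∋ P` of `X'` both `q'♯ρ♯x_m` and `g = i'♯(t⁻¹)^{Dg} ≠ 0` generate `K · 𝒪_{X'}` (A3), so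
  `q'♯ρ♯x_m = v g` with `v` a unit of the domain `Γ(X', O'')`, while
  `q'♯ρ♯b = i'♯π♯β = i'♯η₀ · g`; cancelling `g`, `q'♯c` is a unit on `O''`, so `q' P ∈ D(c)`,
  a principal chart for `b` (`isPrincipalChart_basicOpen_of_eq_mul`);
* `le_preimage_W'` — `q'⁻¹(V'[U a, b]) ⊆ i'⁻¹(𝒞.W')` (this direction uses `β ∈ (J Dg)(W a)`):
  on an affine `O ∋ i' P` over `W a`, (A1) gives `π♯β = η₁ (t⁻¹)^{Dg}`; on a small `O'' ∋ P`
  inside `q'⁻¹W ∩ i'⁻¹O` (`W ∋ q' P` a principal chart for `b`), `q'♯ρ♯b = v g` with `v` a unit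
  and `= i'♯η₁ · g`, so `i'♯η₁ = v` is a unit, `i' P ∈ D(η₁)`, and `D(η₁)` witnesses
  `𝒞.mem_iff`;
* `preimage_W'_eq` — the equality (Q1) of the stub; `stub_qs_atlasQuotientChart` — its registered
  form.

All proofs are glue on Mathlib and the tree; no definitions, no named facts.
-/

noncomputable section

open CategoryTheory CategoryTheory.Limits AlgebraicGeometry TopologicalSpace
open Literature.AlgebraicGeometry.Resolution

set_option linter.dupNamespace false -- mandated namespace `…Theorems.DatumToEmbedded.<Topic>`

namespace Summit.ResolutionOfSingularities.ResolutionOfSingularities.Theorems.DatumToEmbedded.AtlasQuotient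

section Chart

variable {k : Type} [Field k] {Y X V : Scheme.{0}} (f : Y ⟶ Spec (.of k))
  (i : X ⟶ Y) [IsClosedImmersion i] (q : X ⟶ V) {j : ℕ} (𝒜 : GradedAtlas j f i q)
  (J : ℕ → Y.IdealSheafData) (R' : ReesFiltration Y)
  (σX : (R'.strictTransformPlus i.ker).subscheme ⟶ X)
  (hσX : σX ≫ i = (R'.strictTransformPlus i.ker).subschemeι ≫ R'.πPlus)
  (Dg : ℕ) (K : V.IdealSheafData) {V' : Scheme.{0}} (ρ : V' ⟶ V)
  (q' : (R'.strictTransformPlus i.ker).subscheme ⟶ V') (hq' : q' ≫ ρ = σX ≫ q) (a : 𝒜.ι)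

/-! ### Points and sections over the chart `(W a, U a)` -/

include hσX hq' in
/-- A point `P` of `X'` maps into `U a ⊆ V` under `q' ≫ ρ` iff it maps into `W a ⊆ Y` under
`i' ≫ πPlus` (both say `σX P ∈ X ∩ W a = q⁻¹ U a`). [folklore] -/
theorem apply_mem_preimage_iff (P : (R'.strictTransformPlus i.ker).subscheme) :
    q' P ∈ ρ ⁻¹ᵁ (𝒜.U a : V.Opens) ↔
      (R'.strictTransformPlus i.ker).subschemeι P ∈ R'.πPlus ⁻¹ᵁ (𝒜.W a : Y.Opens) := by
  change P ∈ q' ⁻¹ᵁ ρ ⁻¹ᵁ (𝒜.U a : V.Opens) ↔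
    P ∈ (R'.strictTransformPlus i.ker).subschemeι ⁻¹ᵁ R'.πPlus ⁻¹ᵁ (𝒜.W a : Y.Opens)
  rw [← Scheme.Hom.comp_preimage, ← Scheme.Hom.comp_preimage, hq', ← hσX,
    Scheme.Hom.comp_preimage, Scheme.Hom.comp_preimage, 𝒜.preimage_eq a]

include hσX hq' in
/-- **The basic identity of sections**: for `b ∈ Γ(V, U a)` with lift `β`, `i♯β = q♯b`, and opens
`O ⊆ πPlus⁻¹(W a)` of `B₊`, `W ⊆ ρ⁻¹(U a)` of `V'`, `O'' ⊆ q'⁻¹W ∩ i'⁻¹O` of `X'`: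
`q'♯(ρ♯b|_W)|_{O''} = i'♯(πPlus♯β|_O)|_{O''}` (both are `(σX ≫ q)♯ b`). [folklore] -/
theorem appLE_appLE_eq (b : Γ(V, 𝒜.U a)) (β : Γ(Y, 𝒜.W a))
    (hβ : i.app (𝒜.W a) β = q.appLE (𝒜.U a) (i ⁻¹ᵁ (𝒜.W a)) (𝒜.preimage_eq a).le b)
    {O : (R'.plus : Scheme.{0}).Opens} (hO : O ≤ R'.πPlus ⁻¹ᵁ (𝒜.W a : Y.Opens))
    {W : V'.Opens} (hW : W ≤ ρ ⁻¹ᵁ (𝒜.U a : V.Opens))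
    {O'' : (R'.strictTransformPlus i.ker).subscheme.Opens} (h₁ : O'' ≤ q' ⁻¹ᵁ W)
    (h₂ : O'' ≤ (R'.strictTransformPlus i.ker).subschemeι ⁻¹ᵁ O) :
    q'.appLE W O'' h₁ (ρ.appLE (𝒜.U a) W hW b) =
      (R'.strictTransformPlus i.ker).subschemeι.appLE O O'' h₂ (R'.πPlus.appLE (𝒜.W a) O hO β) := by
  have h₃ : O'' ≤ σX ⁻¹ᵁ (i ⁻¹ᵁ (𝒜.W a : Y.Opens)) := by
    rw [← Scheme.Hom.comp_preimage, hσX, Scheme.Hom.comp_preimage]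
    exact fun x hx => hO (h₂ hx)
  have e₁ : ρ.appLE (𝒜.U a) W hW ≫ q'.appLE W O'' h₁ =
      q.appLE (𝒜.U a) (i ⁻¹ᵁ (𝒜.W a)) (𝒜.preimage_eq a).le ≫ σX.appLE (i ⁻¹ᵁ (𝒜.W a)) O'' h₃ :=
    calc ρ.appLE (𝒜.U a) W hW ≫ q'.appLE W O'' h₁ = (q' ≫ ρ).appLE (𝒜.U a) O'' _ :=
          Scheme.Hom.appLE_comp_appLE _ _ _ _ _ _ _
      _ = (σX ≫ q).appLE (𝒜.U a) O'' _ := appLE_congr_hom hq' _ _ _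
      _ = q.appLE (𝒜.U a) (i ⁻¹ᵁ (𝒜.W a)) (𝒜.preimage_eq a).le ≫
            σX.appLE (i ⁻¹ᵁ (𝒜.W a)) O'' h₃ := (Scheme.Hom.appLE_comp_appLE _ _ _ _ _ _ _).symm
  have e₂ : i.app (𝒜.W a) ≫ σX.appLE (i ⁻¹ᵁ (𝒜.W a)) O'' h₃ =
      R'.πPlus.appLE (𝒜.W a) O hO ≫ (R'.strictTransformPlus i.ker).subschemeι.appLE O O'' h₂ :=
    calc i.app (𝒜.W a) ≫ σX.appLE (i ⁻¹ᵁ (𝒜.W a)) O'' h₃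
          = i.appLE (𝒜.W a) (i ⁻¹ᵁ (𝒜.W a)) le_rfl ≫ σX.appLE (i ⁻¹ᵁ (𝒜.W a)) O'' h₃ := by
            rw [Scheme.Hom.app_eq_appLE]
      _ = (σX ≫ i).appLE (𝒜.W a) O'' _ := Scheme.Hom.appLE_comp_appLE _ _ _ _ _ _ _
      _ = ((R'.strictTransformPlus i.ker).subschemeι ≫ R'.πPlus).appLE (𝒜.W a) O'' _ :=
            appLE_congr_hom hσX _ _ _
      _ = R'.πPlus.appLE (𝒜.W a) O hO ≫ (R'.strictTransformPlus i.ker).subschemeι.appLE O O'' h₂ :=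
            (Scheme.Hom.appLE_comp_appLE _ _ _ _ _ _ _).symm
  change (ρ.appLE (𝒜.U a) W hW ≫ q'.appLE W O'' h₁) b =
    (R'.πPlus.appLE (𝒜.W a) O hO ≫ (R'.strictTransformPlus i.ker).subschemeι.appLE O O'' h₂) β
  rw [e₁, ← e₂, CommRingCat.comp_apply, CommRingCat.comp_apply, hβ]

variable [IsIntegral (R'.strictTransformPlus i.ker).subscheme]
  (hτ : ((((R'.strictTransformPlus i.ker).subschemeι ≫ R'.plus.ι ≫ R'.toA1) ⁻¹ᵁ
    PrimeSpectrum.basicOpen (Polynomial.X : Polynomial ReesFiltration.ZZ.{0}) :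
      (R'.strictTransformPlus i.ker).subscheme.Opens) :
        Set (R'.strictTransformPlus i.ker).subscheme).Nonempty)
  (hA3 : K.comap (σX ≫ q) = (R'.excPlus.comap (R'.strictTransformPlus i.ker).subschemeι) ^ Dg)
  (hρ : IsBlowup ρ K)

omit [IsIntegral (R'.strictTransformPlus i.ker).subscheme] in
include hq' hA3 in
/-- **The two generators of `K · 𝒪_{X'}` on a small affine open.** If `W ⊆ V'` is a principal
chart for `(U a, x)` and `O'' ⊆ q'⁻¹ W` is an affine open of `X'`, then `q'♯ρ♯x|_{O''}` and
`(i'♯t⁻¹|_{O''})^{Dg}` generate the same ideal (A3). [folklore] -/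
theorem span_appLE_eq_span_pow {x : Γ(V, 𝒜.U a)} {W : V'.affineOpens}
    (hW : IsPrincipalChart ρ K (𝒜.U a) x W)
    (O'' : (R'.strictTransformPlus i.ker).subscheme.Opens) (hO'' : IsAffineOpen O'')
    (h₁ : O'' ≤ q' ⁻¹ᵁ (W : V'.Opens)) :
    Ideal.span {q'.appLE W O'' h₁ (ρ.appLE (𝒜.U a) W hW.le_preimage x)} =
      Ideal.span {(R'.strictTransformPlus i.ker).subschemeι.appLE ⊤ O'' le_top (tInvOn R' ⊤) ^ Dg} := by
  have h1 := ideal_comap_comap_of_isPrincipalChart hW q' ⟨O'', hO''⟩ h₁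
  rw [← Scheme.IdealSheafData.comap_comp, hq', hA3, comap_excPlus_pow_ideal] at h1
  exact h1.symm

include hσX hq' hτ hA3 hρ in
/-- **`X' ∩ D(β t^{Dg}) ⊆ q'⁻¹(V'[U a, b])`** (see the module docstring). [cite: Wlodarczyk2022, §2.3.3] -/
theorem preimage_W'_le {b : Γ(V, 𝒜.U a)} (hb : b ∈ K.ideal (𝒜.U a)) {β : Γ(Y, 𝒜.W a)}
    (hβ : i.app (𝒜.W a) β = q.appLE (𝒜.U a) (i ⁻¹ᵁ (𝒜.W a)) (𝒜.preimage_eq a).le b)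
    (𝒞 : AmbientChart j f i q 𝒜 J R' Dg a β) :
    (R'.strictTransformPlus i.ker).subschemeι ⁻¹ᵁ (𝒞.W' : (R'.plus : Scheme.{0}).Opens) ≤
      q' ⁻¹ᵁ blowupChart ρ K (𝒜.U a) b := by
  intro P hP
  change (R'.strictTransformPlus i.ker).subschemeι P ∈ (𝒞.W' : (R'.plus : Scheme.{0}).Opens) at hP
  change q' P ∈ blowupChart ρ K (𝒜.U a) b
  obtain ⟨O, hO, hPO, η₀, hη₀, hηeq⟩ := (𝒞.mem_iff _).mp hP
  -- `q' P` lies over `U a`, hence in a principal chart `Wm` for some `xm ∈ K(U a)`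
  have hPU : q' P ∈ ρ ⁻¹ᵁ (𝒜.U a : V.Opens) :=
    (apply_mem_preimage_iff f i q 𝒜 R' σX hσX ρ q' hq' a P).mpr (hO hPO)
  rw [← hρ.iSup_blowupChart (U := 𝒜.U a) (fun s : K.ideal (𝒜.U a) => (s : Γ(V, 𝒜.U a)))
    (by rw [Subtype.range_coe_subtype]; exact Ideal.span_eq _)] at hPU
  obtain ⟨⟨xm, hxm⟩, hPm⟩ := Opens.mem_iSup.mp hPU
  obtain ⟨Wm, hWm, hPWm⟩ := mem_blowupChart_iff.mp hPm
  obtain ⟨c, hc⟩ := hWm.exists_eq_mul hb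
  -- a small affine open `O'' ∋ P` of `X'` inside `q'⁻¹ Wm ∩ i'⁻¹ O`
  obtain ⟨O'', hO''aff, hPO'', hO''le⟩ := exists_isAffineOpen_mem_and_subset
    (X := (R'.strictTransformPlus i.ker).subscheme) (x := P)
    (U := q' ⁻¹ᵁ (Wm : V'.Opens) ⊓ (R'.strictTransformPlus i.ker).subschemeι ⁻¹ᵁ (O : _))
    ⟨hPWm, hPO⟩
  have h₁ : O'' ≤ q' ⁻¹ᵁ (Wm : V'.Opens) := fun x hx => (hO''le hx).1
  have h₂ : O'' ≤ (R'.strictTransformPlus i.ker).subschemeι ⁻¹ᵁ (O : _) := fun x hx => (hO''le hx).2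
  haveI : Nonempty O'' := ⟨⟨P, hPO''⟩⟩
  -- the generator `g = (i'♯t⁻¹)^Dg ≠ 0` of `K · 𝒪_{X'}` on `O''`, and `q'♯ρ♯xm = v · g`
  have hg0 : (R'.strictTransformPlus i.ker).subschemeι.appLE ⊤ O'' le_top (tInvOn R' ⊤) ≠ 0 :=
    appLE_tInvOn_top_ne_zero R' _ hτ O'' ⟨P, hPO''⟩
  obtain ⟨v, hv, hvm⟩ := exists_isUnit_mul_eq_of_span_singleton_eq
    (span_appLE_eq_span_pow f i q 𝒜 R' σX Dg K ρ q' hq' a hA3 hWm O'' hO''aff h₁)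
  -- `i'♯η₀ · g = q'♯ρ♯b = q'♯c · v · g`
  have hchain := appLE_appLE_eq f i q 𝒜 R' σX hσX ρ q' hq' a b β hβ hO hWm.le_preimage h₁ h₂
  have e1 : (R'.strictTransformPlus i.ker).subschemeι.appLE O O'' h₂ (η₀ * tInvOn R' O ^ Dg) =
      (R'.strictTransformPlus i.ker).subschemeι.appLE O O'' h₂ η₀ *
        (R'.strictTransformPlus i.ker).subschemeι.appLE ⊤ O'' le_top (tInvOn R' ⊤) ^ Dg := by
    rw [map_mul, map_pow, appLE_tInvOn]
  have hkey : (R'.strictTransformPlus i.ker).subschemeι.appLE O O'' h₂ η₀ *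
      (R'.strictTransformPlus i.ker).subschemeι.appLE ⊤ O'' le_top (tInvOn R' ⊤) ^ Dg =
      q'.appLE Wm O'' h₁ c * v *
        (R'.strictTransformPlus i.ker).subschemeι.appLE ⊤ O'' le_top (tInvOn R' ⊤) ^ Dg := by
    rw [← e1, hηeq, ← hchain, hc, map_mul, hvm, mul_assoc]
  have hunit : IsUnit (q'.appLE Wm O'' h₁ c) :=
    isUnit_of_mul_isUnit_left (by rw [← mul_right_cancel₀ (pow_ne_zero _ hg0) hkey]; exact hη₀.map _)
  -- hence `q' P ∈ D(c)`, a principal chart for `b`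
  exact (isPrincipalChart_basicOpen_of_eq_mul hWm c hc).le_blowupChart (apply_mem_basicOpen_of_isUnit q' h₁ hunit hPO'')

variable (hexc : (J Dg).comap R'.πPlus = R'.excPlus ^ Dg)

include hσX hq' hτ hA3 hexc in
/-- **`q'⁻¹(V'[U a, b]) ⊆ X' ∩ D(β t^{Dg})`** for `β ∈ (J Dg)(W a)` (see the module docstring).
[cite: Wlodarczyk2022, §2.3.3] -/
theorem le_preimage_W' {b : Γ(V, 𝒜.U a)} {β : Γ(Y, 𝒜.W a)} (hβJ : β ∈ (J Dg).ideal (𝒜.W a))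
    (hβ : i.app (𝒜.W a) β = q.appLE (𝒜.U a) (i ⁻¹ᵁ (𝒜.W a)) (𝒜.preimage_eq a).le b)
    (𝒞 : AmbientChart j f i q 𝒜 J R' Dg a β) :
    q' ⁻¹ᵁ blowupChart ρ K (𝒜.U a) b ≤
      (R'.strictTransformPlus i.ker).subschemeι ⁻¹ᵁ (𝒞.W' : (R'.plus : Scheme.{0}).Opens) := by
  intro P hP
  change q' P ∈ blowupChart ρ K (𝒜.U a) b at hP
  change (R'.strictTransformPlus i.ker).subschemeι P ∈ (𝒞.W' : (R'.plus : Scheme.{0}).Opens)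
  obtain ⟨W, hW, hPW⟩ := mem_blowupChart_iff.mp hP
  -- an affine open `O ∋ i' P` of `B₊` over `W a`; there `π♯β = η₁ (t⁻¹)^Dg` by (A1)
  have hiP : (R'.strictTransformPlus i.ker).subschemeι P ∈ R'.πPlus ⁻¹ᵁ (𝒜.W a : Y.Opens) :=
    (apply_mem_preimage_iff f i q 𝒜 R' σX hσX ρ q' hq' a P).mp (blowupChart_le_preimage ρ K _ b hP)
  obtain ⟨O, hOaff, hPO, hOle⟩ := exists_isAffineOpen_mem_and_subset
    (X := (R'.plus : Scheme.{0})) (x := (R'.strictTransformPlus i.ker).subschemeι P)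
    (U := R'.πPlus ⁻¹ᵁ (𝒜.W a : Y.Opens)) hiP
  have hO : O ≤ R'.πPlus ⁻¹ᵁ (𝒜.W a : Y.Opens) := hOle
  have hmem : R'.πPlus.appLE (𝒜.W a) O hO β ∈ Ideal.span {tInvOn R' O ^ Dg} := by
    rw [← excPlus_pow_ideal R' ⟨O, hOaff⟩, ← hexc, ideal_comap_of_le R'.πPlus (J Dg) (𝒜.W a) ⟨O, hOaff⟩ hO]
    exact Ideal.mem_map_of_mem _ hβJ
  obtain ⟨η₁, hη₁⟩ := Ideal.mem_span_singleton'.mp hmem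
  -- a small affine open `O'' ∋ P` of `X'` inside `q'⁻¹ W ∩ i'⁻¹ O`
  obtain ⟨O'', hO''aff, hPO'', hO''le⟩ := exists_isAffineOpen_mem_and_subset
    (X := (R'.strictTransformPlus i.ker).subscheme) (x := P)
    (U := q' ⁻¹ᵁ (W : V'.Opens) ⊓ (R'.strictTransformPlus i.ker).subschemeι ⁻¹ᵁ O) ⟨hPW, hPO⟩
  have h₁ : O'' ≤ q' ⁻¹ᵁ (W : V'.Opens) := fun x hx => (hO''le hx).1
  have h₂ : O'' ≤ (R'.strictTransformPlus i.ker).subschemeι ⁻¹ᵁ O := fun x hx => (hO''le hx).2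
  haveI : Nonempty O'' := ⟨⟨P, hPO''⟩⟩
  have hg0 : (R'.strictTransformPlus i.ker).subschemeι.appLE ⊤ O'' le_top (tInvOn R' ⊤) ≠ 0 :=
    appLE_tInvOn_top_ne_zero R' _ hτ O'' ⟨P, hPO''⟩
  -- `q'♯ρ♯b = v · g` with `v` a unit, and `= i'♯η₁ · g`
  obtain ⟨v, hv, hvb⟩ := exists_isUnit_mul_eq_of_span_singleton_eq
    (span_appLE_eq_span_pow f i q 𝒜 R' σX Dg K ρ q' hq' a hA3 hW O'' hO''aff h₁)
  have hchain := appLE_appLE_eq f i q 𝒜 R' σX hσX ρ q' hq' a b β hβ hO hW.le_preimage h₁ h₂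
  have e1 : (R'.strictTransformPlus i.ker).subschemeι.appLE O O'' h₂ (η₁ * tInvOn R' O ^ Dg) =
      (R'.strictTransformPlus i.ker).subschemeι.appLE O O'' h₂ η₁ *
        (R'.strictTransformPlus i.ker).subschemeι.appLE ⊤ O'' le_top (tInvOn R' ⊤) ^ Dg := by
    rw [map_mul, map_pow, appLE_tInvOn]
  have hkey : (R'.strictTransformPlus i.ker).subschemeι.appLE O O'' h₂ η₁ *
      (R'.strictTransformPlus i.ker).subschemeι.appLE ⊤ O'' le_top (tInvOn R' ⊤) ^ Dg =
      v * (R'.strictTransformPlus i.ker).subschemeι.appLE ⊤ O'' le_top (tInvOn R' ⊤) ^ Dg := by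
    rw [← e1, hη₁, ← hchain, hvb]
  have hunit : IsUnit ((R'.strictTransformPlus i.ker).subschemeι.appLE O O'' h₂ η₁) := by
    rw [mul_right_cancel₀ (pow_ne_zero _ hg0) hkey]
    exact hv
  -- so `i' P ∈ D(η₁)`, which witnesses `𝒞.mem_iff`
  have hPη : (R'.strictTransformPlus i.ker).subschemeι P ∈ (R'.plus : Scheme.{0}).basicOpen η₁ :=
    apply_mem_basicOpen_of_isUnit _ h₂ hunit hPO''
  have hle : (R'.plus : Scheme.{0}).basicOpen η₁ ≤ O := (R'.plus : Scheme.{0}).basicOpen_le η₁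
  refine (𝒞.mem_iff _).mpr ⟨⟨(R'.plus : Scheme.{0}).basicOpen η₁, hOaff.basicOpen η₁⟩,
    hle.trans hO, hPη, (R'.plus : Scheme.{0}).presheaf.map (homOfLE hle).op η₁,
    (R'.plus : Scheme.{0}).toRingedSpace.isUnit_res_basicOpen η₁, ?_⟩
  change (R'.plus : Scheme.{0}).presheaf.map (homOfLE hle).op η₁ *
      tInvOn R' ((R'.plus : Scheme.{0}).basicOpen η₁) ^ Dg =
    R'.πPlus.appLE (𝒜.W a) ((R'.plus : Scheme.{0}).basicOpen η₁) (hle.trans hO) β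
  rw [← stub_qs_tInvOn_map R' hle, ← map_pow, ← map_mul, hη₁, map_appLE_eq]

include hσX hq' hτ hA3 hρ hexc in
/-- **(Q1) `X' ∩ D(β t^{Dg}) = q'⁻¹(V'[U a, b])`**: the strict transform meets the ambient chart
`𝒞.W'` exactly in the preimage under `q'` of the principal chart of the blow-up downstairs.
[cite: Wlodarczyk2022, §2.3.3] -/
theorem preimage_W'_eq {b : Γ(V, 𝒜.U a)} (hb : b ∈ K.ideal (𝒜.U a)) {β : Γ(Y, 𝒜.W a)}
    (hβJ : β ∈ (J Dg).ideal (𝒜.W a))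
    (hβ : i.app (𝒜.W a) β = q.appLE (𝒜.U a) (i ⁻¹ᵁ (𝒜.W a)) (𝒜.preimage_eq a).le b)
    (𝒞 : AmbientChart j f i q 𝒜 J R' Dg a β) :
    (R'.strictTransformPlus i.ker).subschemeι ⁻¹ᵁ (𝒞.W' : (R'.plus : Scheme.{0}).Opens) =
      q' ⁻¹ᵁ blowupChart ρ K (𝒜.U a) b :=
  le_antisymm (preimage_W'_le f i q 𝒜 J R' σX hσX Dg K ρ q' hq' a hτ hA3 hρ hb hβ 𝒞)
    (le_preimage_W' f i q 𝒜 J R' σX hσX Dg K ρ q' hq' a hτ hA3 hexc hβJ hβ 𝒞)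

end Chart

/-! ## Registered form -/

/-- **Registered sub-goal `stub_qs_atlasQuotientChart`** of the crux (helper of the stub
`stub_qs_atlas_quotient`): (Q1) `X' ∩ D(β t^{Dg}) = q'⁻¹(V'[U a, b])` for `b ∈ K(U a)` with a lift
`β ∈ J_{Dg}(W a)`, in the abstract setting of this file. [cite: Wlodarczyk2022, §2.3.3] -/
theorem stub_qs_atlasQuotientChart :
    ∀ {k : Type} [Field k] {Y X V : Scheme.{0}} (f : Y ⟶ Spec (.of k)) (i : X ⟶ Y)
      [IsClosedImmersion i] (q : X ⟶ V) {j : ℕ}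
      (𝒜 : Summit.ResolutionOfSingularities.ResolutionOfSingularities.Theorems.GradedAtlas j f i q)
      (J : ℕ → Y.IdealSheafData) (R' : Literature.AlgebraicGeometry.Resolution.ReesFiltration Y)
      (σX : (R'.strictTransformPlus i.ker).subscheme ⟶ X),
      σX ≫ i = (R'.strictTransformPlus i.ker).subschemeι ≫ R'.πPlus →
      ∀ (Dg : ℕ) (K : V.IdealSheafData) {V' : Scheme.{0}} (ρ : V' ⟶ V)
        (q' : (R'.strictTransformPlus i.ker).subscheme ⟶ V'), q' ≫ ρ = σX ≫ q →
      ∀ (a : 𝒜.ι) [IsIntegral (R'.strictTransformPlus i.ker).subscheme],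
      ((((R'.strictTransformPlus i.ker).subschemeι ≫ R'.plus.ι ≫ R'.toA1) ⁻¹ᵁ
        PrimeSpectrum.basicOpen (Polynomial.X :
          Polynomial Literature.AlgebraicGeometry.Resolution.ReesFiltration.ZZ.{0}) :
            (R'.strictTransformPlus i.ker).subscheme.Opens) :
              Set (R'.strictTransformPlus i.ker).subscheme).Nonempty →
      K.comap (σX ≫ q) = (R'.excPlus.comap (R'.strictTransformPlus i.ker).subschemeι) ^ Dg →
      Literature.AlgebraicGeometry.Resolution.IsBlowup ρ K →
      (J Dg).comap R'.πPlus = R'.excPlus ^ Dg →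
      ∀ {b : Γ(V, 𝒜.U a)}, b ∈ K.ideal (𝒜.U a) →
      ∀ {β : Γ(Y, 𝒜.W a)}, β ∈ (J Dg).ideal (𝒜.W a) →
      i.app (𝒜.W a) β = q.appLE (𝒜.U a) (i ⁻¹ᵁ (𝒜.W a)) (𝒜.preimage_eq a).le b →
      ∀ (𝒞 : Summit.ResolutionOfSingularities.ResolutionOfSingularities.Theorems.AmbientChart
        j f i q 𝒜 J R' Dg a β),
      (R'.strictTransformPlus i.ker).subschemeι ⁻¹ᵁ (𝒞.W' : (R'.plus : Scheme.{0}).Opens) =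
        q' ⁻¹ᵁ Literature.AlgebraicGeometry.Resolution.blowupChart ρ K (𝒜.U a) b :=
  fun f i _ q _ 𝒜 J R' σX hσX Dg K _ ρ q' hq' a _ hτ hA3 hρ hexc _ hb _ hβJ hβ 𝒞 =>
    preimage_W'_eq f i q 𝒜 J R' σX hσX Dg K ρ q' hq' a hτ hA3 hρ hexc hb hβJ hβ 𝒞

end Summit.ResolutionOfSingularities.ResolutionOfSingularities.Theorems.DatumToEmbedded.AtlasQuotient

end
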